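import Literature.NumberTheory.EllipticCurves.AnticyclotomicBigGaloisRep
import Summits.BirchSwinnertonDyer.BirchSwinnertonDyer.Theorems.EisensteinPrimesBSDpOnCellCTelescopeK2PurityCoreAtBadPrimes
import HarnessLib

/-!
# Crux 4 `BSDpOnCellC` (stmt-BirchSwinnertonDyer-19034), line «telescope», node W4⁰ (`K2Weight2.stub_bigPseudoNullPTorsion`),
# route G′ — model fact (M2): the big representation `Maps_sm(ℤ_p, A)` is `T`-DIVISIBLE, and so is its `p^a`-torsion
# (ideator bsd-idea-12 g39; `--supports`, helper; closes nothing)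

Context. Part 2 of the route-G′ core algebra (`…Theorems.TelescopeK2PurityCoreAtBadPrimes`, p757620) certifies the
almost-divisible core `p^a · L(K_w, 𝐃)` at a place `w ∣ N` from three MODEL facts about `M = 𝐃^{I_w}`: its character
module is finitely generated over `B = 𝒪⟦T⟧`, `M` is `T`-divisible, and every `M[p^a]` is `T`-divisible. This file proves
the two divisibilities for the co-induced model `BigRepModule 𝒪 p A = Maps_sm(ℤ_p, A)` of the tree
(`Literature/NumberTheory/EllipticCurves/AnticyclotomicBigGaloisRep.lean`: smooth `p`-primary maps `ℤ_p → A`, `T` acting as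
`τ₁ − 1`, `BigRepModule.X_smul_apply`), for ANY commutative ring `𝒪` and ANY `𝒪`-module `A`, with values constrained to an
arbitrary subgroup `P ≤ A` (so that the submodule of maps valued in `A^{I_w}` — the inertia invariants when `κ|_{I_w} = 1` —
and its `p^a`-torsion are covered):

* `exists_X_smul_eq_of_forall_mem`: for `Ψ ∈ Maps_sm(ℤ_p, A)` with values in `P` there is `Φ` with values in `P` and
  `T • Φ = Ψ`. Construction: `Ψ` has level `n` and `p^k`-torsion values; put `Φ(x) := Σ_{i < x mod p^{n+k}} Ψ(i)`
  (`x mod p^{n+k}` = `PadicInt.appr x (n+k)`); then `Φ(x+1) − Φ(x) = Ψ(x)` because the full-period sum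
  `Σ_{i < p^{n+k}} Ψ(i) = p^k · Σ_{j < p^n} Ψ(j) = 0` (`sum_range_pow_apply_eq_zero`, `sum_range_mul_mod`);
* `exists_X_smul_eq`, `exists_X_smul_eq_of_pow_smul_eq_zero` (`P = ⊤`, `P = A[p^a]`), and the SUBMODULE forms
  `exists_X_smul_eq_of_mem_iff`, `exists_X_smul_eq_of_pow_smul_eq_zero_of_mem_iff` for a `B`-submodule `M'` cut out by
  a value condition `Φ ∈ M' ↔ ∀ x, Φ x ∈ A₀` — literally the hypotheses `hdiv`, `hdiva` of part 2;
* docking (`exists_hasNoPseudoNullSubmodule_range_lsmul_pow_characterModule_bigRepModule`): over `𝒪 = ℤ_p⟦X⟧`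
  (`B = IwasawaAlgebra₂ p`), granted finite generation of the character module, SOME `p^a · Maps_sm(ℤ_p, A)^∨` — and the
  same for a value-cut submodule — has no non-zero pseudo-null `B`-submodule (part 2
  `exists_hasNoPseudoNullSubmodule_range_lsmul_pow_characterModule` applied to the facts above).

HONESTY. Elementary and model-internal; nothing here proves W4⁰, W4, N2, the crux `BSDpOnCellC` or any summit statement;
the identification `(M₂)^{I_w} = {Φ | ∀ x, Φ x ∈ A₂^{I_w}}` (κ unramified at `w ∤ p`), the cofinite generation, the quotient
map onto `L(K_w, 𝐃)` and Greenberg's Prop. 4.1.1 (c) for the core specification remain displayed, not claimed. BSD is proved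
for no curve. AI-typed, kernel-checked; theorems only (no `def`, no instance, no named fact, no `sorry`).

[cite: SkinnerUrban2014, §3.1.3 and proof of Prop. 3.2.3 (Λ^* = lim Maps(Γ/Γ^{pⁿ}, ·))] [cite: Castella2018, §2.1–2.2 (𝒜 = T ⊗ Λ^*, T ↦ γ − 1)]
[cite: Greenberg2016Selmer, §4.2 p. 19 L25–31] [cite: Greenberg2006, Prop. 2.4]
-/

set_option autoImplicit false
-- every decl lives in the file's own namespace; the linter fires on the path-vs-namespace mismatch only
set_option linter.dupNamespace false

open scoped Classical
open Literature.NumberTheory.EllipticCurves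
open Literature.NumberTheory.IwasawaTheory.Greenberg2016

namespace Summit.BirchSwinnertonDyer.BirchSwinnertonDyer.Theorems.TelescopeK2BigRepTDivisible

/-! ## §1 Arithmetic: residues and full-period sums -/

section Arithmetic

/-- `Σ_{i < a·b} f(i mod a) = b · Σ_{j < a} f(j)`. [folklore] -/
theorem sum_range_mul_mod {M : Type*} [AddCommMonoid M] (f : ℕ → M) (a b : ℕ) :
    ∑ i ∈ Finset.range (a * b), f (i % a) = b • ∑ j ∈ Finset.range a, f j := by
  induction b with
  | zero => rw [mul_zero, Finset.sum_range_zero, zero_smul]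
  | succ b ih =>
    rw [Nat.mul_succ, Finset.sum_range_add, ih, succ_nsmul]
    congr 1
    refine Finset.sum_congr rfl fun x hx ↦ ?_
    rw [add_comm, Nat.add_mul_mod_self_left, Nat.mod_eq_of_lt (Finset.mem_range.mp hx)]

variable {p : ℕ} [Fact p.Prime]

/-- The residue `x mod p^N ∈ [0, p^N)` (`PadicInt.appr`) is characterised by `x − a ∈ p^N ℤ_p`, `a < p^N`.
[folklore] -/
theorem appr_eq_of_sub_mem {N : ℕ} {x : ℤ_[p]} {a : ℕ} (ha : a < p ^ N)
    (h : x - a ∈ Ideal.span {(p : ℤ_[p]) ^ N}) : x.appr N = a := by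
  have hc := PadicInt.zmod_congr_of_sub_mem_span N x (x.appr N) a (PadicInt.appr_spec N x) h
  rwa [ZMod.natCast_eq_natCast_iff', Nat.mod_eq_of_lt (PadicInt.appr_lt x N), Nat.mod_eq_of_lt ha] at hc

/-- `i ≡ i mod p^n (mod p^n ℤ_p)` for a natural number `i`. [folklore] -/
theorem natCast_sub_natCast_mod_mem (n i : ℕ) :
    ((i : ℕ) : ℤ_[p]) - ((i % p ^ n : ℕ) : ℤ_[p]) ∈ Ideal.span {(p : ℤ_[p]) ^ n} := by
  refine Ideal.mem_span_singleton'.mpr ⟨((i / p ^ n : ℕ) : ℤ_[p]), ?_⟩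
  have h := Nat.div_add_mod i (p ^ n)
  rw [eq_sub_iff_add_eq]
  exact_mod_cast (by rw [mul_comm]; exact h : i / p ^ n * p ^ n + i % p ^ n = i)

end Arithmetic

/-! ## §2 `T`-divisibility of `Maps_sm(ℤ_p, A)` with controlled values -/

section BigRep

variable {𝒪 : Type*} [CommRing 𝒪] {p : ℕ} [Fact p.Prime] {A : Type*} [AddCommGroup A] [Module 𝒪 A]

/-- A map of level `n` takes the same value at `i` and at `i mod p^n`. [cite: SkinnerUrban2014, §3.1.3 (Maps(Γ/Γ^{pⁿ}, ·))] -/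
theorem apply_natCast_eq_apply_mod {n : ℕ} {Ψ : BigRepModule 𝒪 p A} (hΨ : IsSmoothOfLevel p A n Ψ) (i : ℕ) :
    Ψ (i : ℤ_[p]) = Ψ ((i % p ^ n : ℕ) : ℤ_[p]) :=
  hΨ _ _ (natCast_sub_natCast_mod_mem n i)

/-- **Full-period sums vanish**: if `Ψ` has level `n` and `p^k`-torsion values then `Σ_{i < p^{n+k}} Ψ(i) = p^k · Σ_{j < p^n} Ψ(j) = 0`.
[cite: SkinnerUrban2014, §3.1.3 (Maps(Γ/Γ^{pⁿ}, ·))] -/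
theorem sum_range_pow_apply_eq_zero {n k : ℕ} {Ψ : BigRepModule 𝒪 p A} (hn : IsSmoothOfLevel p A n Ψ)
    (hk : ∀ x, p ^ k • Ψ x = 0) : ∑ i ∈ Finset.range (p ^ (n + k)), Ψ (i : ℤ_[p]) = 0 := by
  rw [pow_add]
  calc ∑ i ∈ Finset.range (p ^ n * p ^ k), Ψ (i : ℤ_[p])
      = ∑ i ∈ Finset.range (p ^ n * p ^ k), Ψ ((i % p ^ n : ℕ) : ℤ_[p]) :=
        Finset.sum_congr rfl fun i _ ↦ apply_natCast_eq_apply_mod hn i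
    _ = p ^ k • ∑ j ∈ Finset.range (p ^ n), Ψ (j : ℤ_[p]) := sum_range_mul_mod (fun j ↦ Ψ (j : ℤ_[p])) _ _
    _ = 0 := by
        rw [Finset.smul_sum]
        exact Finset.sum_eq_zero fun j _ ↦ hk _

/-- **`Maps_sm(ℤ_p, A)` is `T`-divisible, with controlled values.** For `Ψ` with values in a subgroup `P ≤ A` there is
`Φ` with values in `P` and `T • Φ = Φ(· + 1) − Φ = Ψ`: `Φ(x) := Σ_{i < x mod p^{n+k}} Ψ(i)` where `Ψ` has level `n` and
`p^k`-torsion values (the wrap-around at `x mod p^{n+k} = p^{n+k} − 1` is the vanishing of the full-period sum).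
[cite: SkinnerUrban2014, §3.1.3 and proof of Prop. 3.2.3] [cite: Castella2018, §2.2 (T ↦ γ − 1)] -/
theorem exists_X_smul_eq_of_forall_mem (P : AddSubgroup A) (Ψ : BigRepModule 𝒪 p A) (hΨ : ∀ x, Ψ x ∈ P) :
    ∃ Φ : BigRepModule 𝒪 p A, (∀ x, Φ x ∈ P) ∧ (PowerSeries.X : PowerSeries 𝒪) • Φ = Ψ := by
  obtain ⟨n, hn⟩ := Ψ.exists_level
  obtain ⟨k, hk⟩ := Ψ.exists_torsion
  have hΦ₀ : (fun x : ℤ_[p] ↦ ∑ i ∈ Finset.range (x.appr (n + k)), Ψ (i : ℤ_[p])) ∈ bigRepSubmodule 𝒪 p A := by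
    refine ⟨⟨n + k, fun x y hxy ↦ ?_⟩, ⟨k, fun x ↦ ?_⟩⟩
    · have hy : x - ↑(y.appr (n + k)) ∈ Ideal.span {(p : ℤ_[p]) ^ (n + k)} := by
        have h := Ideal.add_mem _ hxy (PadicInt.appr_spec (n + k) y)
        rwa [sub_add_sub_cancel] at h
      simp only [appr_eq_of_sub_mem (PadicInt.appr_lt y (n + k)) hy]
    · simp only [Finset.smul_sum, hk, Finset.sum_const_zero]
  refine ⟨BigRepModule.mk _ hΦ₀, fun x ↦ ?_, ?_⟩
  · rw [BigRepModule.mk_apply]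
    exact sum_mem fun i _ ↦ hΨ _
  · ext x
    rw [BigRepModule.X_smul_apply, BigRepModule.mk_apply, BigRepModule.mk_apply]
    have hx := PadicInt.appr_spec (n + k) x
    have hlt := PadicInt.appr_lt x (n + k)
    have hΨx : Ψ ((x.appr (n + k) : ℕ) : ℤ_[p]) = Ψ x := hn _ _ (by
      rw [← neg_sub, Ideal.neg_mem_iff]
      exact Ideal.span_singleton_le_span_singleton.mpr (pow_dvd_pow _ (Nat.le_add_right n k)) hx)
    rcases Nat.lt_or_ge (x.appr (n + k) + 1) (p ^ (n + k)) with h | h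
    · have happr : (x + 1).appr (n + k) = x.appr (n + k) + 1 :=
        appr_eq_of_sub_mem h (by push_cast; rwa [add_sub_add_right_eq_sub])
      rw [happr, Finset.sum_range_succ, add_sub_cancel_left, hΨx]
    · have heq : x.appr (n + k) + 1 = p ^ (n + k) := le_antisymm (Nat.succ_le_of_lt hlt) h
      have happr : (x + 1).appr (n + k) = 0 := by
        refine appr_eq_of_sub_mem (Nat.zero_lt_of_lt hlt) ?_
        have h1 : (x + 1 : ℤ_[p]) - ((0 : ℕ) : ℤ_[p]) =
            (x - (x.appr (n + k) : ℤ_[p])) + ((x.appr (n + k) + 1 : ℕ) : ℤ_[p]) := by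
          push_cast; ring
        rw [h1, heq, Nat.cast_pow]
        exact Ideal.add_mem _ hx (Ideal.mem_span_singleton_self _)
      have hsum := sum_range_pow_apply_eq_zero hn hk
      rw [← heq, Finset.sum_range_succ, hΨx] at hsum
      rw [happr, Finset.sum_range_zero, zero_sub]
      exact neg_eq_of_add_eq_zero_right hsum

/-- **`Maps_sm(ℤ_p, A)` is `T`-divisible.** [cite: SkinnerUrban2014, §3.1.3 and proof of Prop. 3.2.3] -/
theorem exists_X_smul_eq (Ψ : BigRepModule 𝒪 p A) :
    ∃ Φ : BigRepModule 𝒪 p A, (PowerSeries.X : PowerSeries 𝒪) • Φ = Ψ := by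
  obtain ⟨Φ, -, h⟩ := exists_X_smul_eq_of_forall_mem ⊤ Ψ (fun _ ↦ AddSubgroup.mem_top _)
  exact ⟨Φ, h⟩

/-- The scalar `p^a ∈ 𝒪⟦T⟧` acts on `Maps_sm(ℤ_p, A)` values-wise as multiplication by `p^a`.
[cite: Castella2018, §2.2 (ℤ_p[[T]] = Λ via 1 + T ↦ γ)] -/
theorem pow_natCast_smul_apply (a : ℕ) (Φ : BigRepModule 𝒪 p A) (x : ℤ_[p]) :
    (((p : PowerSeries 𝒪) ^ a) • Φ) x = p ^ a • Φ x := by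
  rw [show ((p : PowerSeries 𝒪) ^ a) = PowerSeries.C (((p ^ a : ℕ) : 𝒪)) by
      rw [Nat.cast_pow, map_pow, map_natCast],
    BigRepModule.C_smul, BigRepModule.smul_apply, Nat.cast_smul_eq_nsmul]

/-- **The `p^a`-torsion of `Maps_sm(ℤ_p, A)` is `T`-divisible, with controlled values**: a `p^a`-torsion `Ψ` with
values in `P` is `T • Φ` for a `p^a`-torsion `Φ` with values in `P` (apply the main lemma to `P ⊓ A[p^a]`).
[cite: SkinnerUrban2014, §3.1.3 and proof of Prop. 3.2.3] -/
theorem exists_X_smul_eq_of_pow_smul_eq_zero_of_forall_mem (P : AddSubgroup A) (a : ℕ) (Ψ : BigRepModule 𝒪 p A)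
    (hP : ∀ x, Ψ x ∈ P) (hΨ : ((p : PowerSeries 𝒪) ^ a) • Ψ = 0) :
    ∃ Φ : BigRepModule 𝒪 p A, (∀ x, Φ x ∈ P) ∧ ((p : PowerSeries 𝒪) ^ a) • Φ = 0 ∧
      (PowerSeries.X : PowerSeries 𝒪) • Φ = Ψ := by
  have hΨ' : ∀ x, Ψ x ∈ P ⊓ (nsmulAddMonoidHom (p ^ a) : A →+ A).ker := fun x ↦ by
    refine AddSubgroup.mem_inf.mpr ⟨hP x, ?_⟩
    rw [AddMonoidHom.mem_ker, nsmulAddMonoidHom_apply, ← pow_natCast_smul_apply, hΨ, BigRepModule.zero_apply]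
  obtain ⟨Φ, hΦ, h⟩ := exists_X_smul_eq_of_forall_mem _ Ψ hΨ'
  refine ⟨Φ, fun x ↦ (AddSubgroup.mem_inf.mp (hΦ x)).1, ?_, h⟩
  ext x
  rw [pow_natCast_smul_apply, BigRepModule.zero_apply]
  have hx := (AddSubgroup.mem_inf.mp (hΦ x)).2
  rwa [AddMonoidHom.mem_ker, nsmulAddMonoidHom_apply] at hx

/-- **The `p^a`-torsion of `Maps_sm(ℤ_p, A)` is `T`-divisible.** [cite: SkinnerUrban2014, §3.1.3 and proof of Prop. 3.2.3] -/
theorem exists_X_smul_eq_of_pow_smul_eq_zero (a : ℕ) (Ψ : BigRepModule 𝒪 p A)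
    (hΨ : ((p : PowerSeries 𝒪) ^ a) • Ψ = 0) :
    ∃ Φ : BigRepModule 𝒪 p A, ((p : PowerSeries 𝒪) ^ a) • Φ = 0 ∧ (PowerSeries.X : PowerSeries 𝒪) • Φ = Ψ := by
  obtain ⟨Φ, -, h0, h⟩ := exists_X_smul_eq_of_pow_smul_eq_zero_of_forall_mem ⊤ a Ψ (fun _ ↦ AddSubgroup.mem_top _) hΨ
  exact ⟨Φ, h0, h⟩

/-- **Submodule form (`hdiv` of part 2)**: a `𝒪⟦T⟧`-submodule `M'` of `Maps_sm(ℤ_p, A)` cut out by a value condition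
`Φ ∈ M' ↔ ∀ x, Φ x ∈ A₀` (e.g. the maps valued in `A^{I_w}` = the inertia invariants when the character is unramified at `w`)
is `T`-divisible. [cite: SkinnerUrban2014, §3.1.3 and proof of Prop. 3.2.3] [cite: Greenberg2016Selmer, §4.2 p. 19 L25–31] -/
theorem exists_X_smul_eq_of_mem_iff (A₀ : AddSubgroup A) (M' : Submodule (PowerSeries 𝒪) (BigRepModule 𝒪 p A))
    (hM' : ∀ Φ : BigRepModule 𝒪 p A, Φ ∈ M' ↔ ∀ x, Φ x ∈ A₀) :
    ∀ m : ↥M', ∃ m' : ↥M', (PowerSeries.X : PowerSeries 𝒪) • m' = m := by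
  intro m
  obtain ⟨Φ, hΦ, h⟩ := exists_X_smul_eq_of_forall_mem A₀ (m : BigRepModule 𝒪 p A) ((hM' _).mp m.2)
  exact ⟨⟨Φ, (hM' Φ).mpr hΦ⟩, Subtype.ext h⟩

/-- **Submodule form (`hdiva` of part 2)**: in a value-cut `𝒪⟦T⟧`-submodule `M'` of `Maps_sm(ℤ_p, A)`, every `p^a`-torsion
element is `T • m'` for a `p^a`-torsion `m' ∈ M'`. [cite: SkinnerUrban2014, §3.1.3 and proof of Prop. 3.2.3] [cite: Greenberg2016Selmer, §4.2 p. 19 L25–31] -/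
theorem exists_X_smul_eq_of_pow_smul_eq_zero_of_mem_iff (A₀ : AddSubgroup A)
    (M' : Submodule (PowerSeries 𝒪) (BigRepModule 𝒪 p A))
    (hM' : ∀ Φ : BigRepModule 𝒪 p A, Φ ∈ M' ↔ ∀ x, Φ x ∈ A₀) :
    ∀ (a : ℕ) (m : ↥M'), ((p : PowerSeries 𝒪) ^ a) • m = 0 →
      ∃ m' : ↥M', ((p : PowerSeries 𝒪) ^ a) • m' = 0 ∧ (PowerSeries.X : PowerSeries 𝒪) • m' = m := by
  intro a m hm
  obtain ⟨Φ, hΦ, h0, h⟩ := exists_X_smul_eq_of_pow_smul_eq_zero_of_forall_mem A₀ a (m : BigRepModule 𝒪 p A)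
    ((hM' _).mp m.2) (by rw [← Submodule.coe_smul, hm, Submodule.coe_zero])
  exact ⟨⟨Φ, (hM' Φ).mpr hΦ⟩, Subtype.ext h0, Subtype.ext h⟩

end BigRep

/-! ## §3 Docking with part 2 over `B = ℤ_p⟦X⟧⟦T⟧` -/

section Docking

variable (p : ℕ) [Fact p.Prime]

/-- **Some `p^a · Maps_sm(ℤ_p, A)^∨` has no non-zero pseudo-null `B`-submodule** (`𝒪 = ℤ_p⟦X⟧`, `B = 𝒪⟦T⟧ =
IwasawaAlgebra₂ p`), granted finite generation of the character module over `B`: part 2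
`exists_hasNoPseudoNullSubmodule_range_lsmul_pow_characterModule` fed with §2. [cite: Greenberg2016Selmer, §4.2 p. 19 L25–31]
[cite: Greenberg2006, Prop. 2.4] -/
theorem exists_hasNoPseudoNullSubmodule_range_lsmul_pow_characterModule_bigRepModule (A : Type)
    [AddCommGroup A] [Module (IwasawaAlgebra p) A]
    [Module.Finite (IwasawaAlgebra₂ p) (CharacterModule (BigRepModule (IwasawaAlgebra p) p A))] :
    ∃ a : ℕ, HasNoPseudoNullSubmodule (IwasawaAlgebra₂ p)
      ↥(LinearMap.range (LinearMap.lsmul (IwasawaAlgebra₂ p)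
        (CharacterModule (BigRepModule (IwasawaAlgebra p) p A)) (((p : ℕ) : IwasawaAlgebra₂ p) ^ a))) :=
  TelescopeK2PurityCoreAtBadPrimes.exists_hasNoPseudoNullSubmodule_range_lsmul_pow_characterModule p
    (BigRepModule (IwasawaAlgebra p) p A) exists_X_smul_eq (fun a m hm ↦ exists_X_smul_eq_of_pow_smul_eq_zero a m hm)

/-- **The same for a value-cut `B`-submodule** `M' = {Φ | ∀ x, Φ x ∈ A₀}` of `Maps_sm(ℤ_p, A)` (read: `𝐃^{I_w}`,
`A₀ = A^{I_w}`), granted finite generation of its character module. [cite: Greenberg2016Selmer, §4.2 p. 19 L25–31]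
[cite: Greenberg2006, Prop. 2.4] -/
theorem exists_hasNoPseudoNullSubmodule_range_lsmul_pow_characterModule_of_mem_iff (A : Type)
    [AddCommGroup A] [Module (IwasawaAlgebra p) A] (A₀ : AddSubgroup A)
    (M' : Submodule (IwasawaAlgebra₂ p) (BigRepModule (IwasawaAlgebra p) p A))
    (hM' : ∀ Φ : BigRepModule (IwasawaAlgebra p) p A, Φ ∈ M' ↔ ∀ x, Φ x ∈ A₀)
    [Module.Finite (IwasawaAlgebra₂ p) (CharacterModule ↥M')] :
    ∃ a : ℕ, HasNoPseudoNullSubmodule (IwasawaAlgebra₂ p)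
      ↥(LinearMap.range (LinearMap.lsmul (IwasawaAlgebra₂ p) (CharacterModule ↥M')
        (((p : ℕ) : IwasawaAlgebra₂ p) ^ a))) :=
  TelescopeK2PurityCoreAtBadPrimes.exists_hasNoPseudoNullSubmodule_range_lsmul_pow_characterModule p ↥M'
    (exists_X_smul_eq_of_mem_iff A₀ M' hM') (exists_X_smul_eq_of_pow_smul_eq_zero_of_mem_iff A₀ M' hM')

/-- **The almost-divisible local core, model form**: for a local condition `N ≤ H` that is a `B`-quotient of a value-cut
submodule `M'` of `Maps_sm(ℤ_p, A)` with finitely generated character module, SOME `p^a • N` is almost divisible.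
[cite: Greenberg2016Selmer, §2.5 p. 8 L35–37, Remark 3.1.2, §4.2 p. 19 L25–31] [cite: Greenberg2006, Prop. 2.4] -/
theorem exists_isAlmostDivisible_map_lsmul_pow_of_surjective_of_mem_iff (A : Type) [AddCommGroup A]
    [Module (IwasawaAlgebra p) A] (A₀ : AddSubgroup A)
    (M' : Submodule (IwasawaAlgebra₂ p) (BigRepModule (IwasawaAlgebra p) p A))
    (hM' : ∀ Φ : BigRepModule (IwasawaAlgebra p) p A, Φ ∈ M' ↔ ∀ x, Φ x ∈ A₀)
    [Module.Finite (IwasawaAlgebra₂ p) (CharacterModule ↥M')]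
    {H : Type} [AddCommGroup H] [Module (IwasawaAlgebra₂ p) H] (N : Submodule (IwasawaAlgebra₂ p) H)
    (π : ↥M' →ₗ[IwasawaAlgebra₂ p] ↥N) (hπ : Function.Surjective π) :
    ∃ a : ℕ, IsAlmostDivisible (IwasawaAlgebra₂ p)
      ↥(N.map (LinearMap.lsmul (IwasawaAlgebra₂ p) H (((p : ℕ) : IwasawaAlgebra₂ p) ^ a))) :=
  TelescopeK2PurityCoreAtBadPrimes.exists_isAlmostDivisible_map_lsmul_pow_of_surjective p N π hπ
    (exists_X_smul_eq_of_mem_iff A₀ M' hM') (exists_X_smul_eq_of_pow_smul_eq_zero_of_mem_iff A₀ M' hM')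

end Docking

end Summit.BirchSwinnertonDyer.BirchSwinnertonDyer.Theorems.TelescopeK2BigRepTDivisible
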